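import Literature.AlgebraicGeometry.Motives.AbelianVarietyConjugate
import Literature.AlgebraicGeometry.Motives.AbelianVarietyEndGaloisDescent
import HarnessLib

/-!
# The conjugate of a base change: `(P ⊗_K L)^σ ≅ P ⊗_K L` for `σ ∈ Aut(L/K)`
# (Shimura 1998, §21.1 proof of Prop. 21.1 and §21.4, proof of Thm. 21.4, pp. 147–148; Milne 2005, §11 p. 108)

For an abelian variety `P` over `K`, a field extension `L / K` and `σ ∈ Aut(L/K)`, the conjugate
`(P_L)^σ = P_L ×_{Spec L, Spec σ} Spec L` (the tree's `AbelianVariety.conjugate`, Shimura's `A^σ`,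
`Motives/AbelianVarietyConjugate`) of the base change `P_L = P ⊗_K L` is canonically isomorphic to
`P_L` itself, because `σ` fixes `K` («`ι(a)^σ = ι(a)`», «`f^σ = f` for `f` rational over `K`»; in
Shimura's proofs of Prop. 21.1 and Thm. 21.4 this identification is used silently whenever `σ`
fixes a field of definition: «`y^σ = (f^σ)⁻¹(e^σ) = … = y`. Thus `y` is rational over `k₀`»).
In the tree this isomorphism ALREADY EXISTS at the level of group `L`-schemes as
`AbelianVariety.twistGrpIso L σ P` (`Motives/AbelianVarietyEndGaloisDescent`: the twist functor
`twist L σ = Over.pullback (Spec σ)` IS base change along `AlongHom L σ`, definitionally), where it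
defines the Galois conjugate `galConj σ r` of an endomorphism.  This file packages it as an
isomorphism of ABELIAN VARIETIES and records the dictionary needed to read Shimura's `λ_σ : A → A^σ`
(§21.4) against the tree's Galois-descent data (`gal`, `galConj`, `RelativeSpec.ActionOver`):

* `conjugateBaseChangeIso L σ P : (P.baseChange L).conjugate σ.toRingEquiv ≅ P.baseChange L`;
* on schemes: `hom ≫ pr_P = (A^σ → A) ≫ pr_P` and `inv ≫ (A^σ → A) = gal σ⁻¹ = 1 × Spec σ`
  (`toSchemeHom_conjugateBaseChangeIso_inv_comp_baseChangeHomFst`);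
* on points: `x ↦ x^σ` on `P_L(L)` (`conjPoints`) followed by the isomorphism is the Galois action
  `σ • x` on `P(L)` (`map_conjugateBaseChangeIso_hom_conjPoints`, through `pointsMulEquiv : P(L) ≃* P_L(L)`);
* naturality in `P` (`conjugate_baseChange_comp_conjugateBaseChangeIso_hom`: `(f_L)^σ ≫ e_Q = e_P ≫ f_L`),
  in particular `K`-rational endomorphisms commute with it;
* `galConj σ r = e⁻¹ ≫ r^σ ≫ e` (`galConj_eq_conj`): the Galois action on `End(P_L)` is conjugation
  by `σ` read through the identification.

Everything is proved (mostly by `rfl` from the two cited files); no definition of a notion, no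
named fact.  Universe-monomorphic in `u` like `Motives.AbelianVariety`.

## References

* [Shimura1998] G. Shimura, *Abelian Varieties with Complex Multiplication and Modular Functions*
  (1998), §21.1, proof of Prop. 21.1 (pp. 145–146: «`y^σ = … = y`»), §21.4, proof of Thm. 21.4 (pp. 147–148: `λ_σ : A → A^σ`,
  `μ = μ^σ ∘ λ_σ`).
* [Milne2005ShimuraVarieties] J. S. Milne, *Introduction to Shimura varieties*, §11 p. 108 (`σV`,
  `σα`), §13 Prop. 13.1 (the action of `Aut(Ω/k)` on `V_Ω`).
* [GortzWedhorn2020] U. Görtz, T. Wedhorn, *Algebraic Geometry I*, §(14.20) (Galois descent data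
  `φ_σ : σ^*X → X`).
-/

noncomputable section

open CategoryTheory CategoryTheory.Limits AlgebraicGeometry

universe u

namespace Literature.AlgebraicGeometry.Motives

namespace AbelianVariety

open scoped MonObj

set_option backward.isDefEq.respectTransparency false

variable {K : Type u} [Field K] (L : Type u) [Field L] [Algebra K L] (σ : L ≃ₐ[K] L)
  (P : AbelianVariety K)

/-! ### The isomorphism `(P_L)^σ ≅ P_L` -/

/-- The twist functor `X ↦ X ×_{Spec L, Spec σ} Spec L` of `Motives/AbelianVarietyEndGaloisDescent` IS
base change along `L → L, x ↦ σ x` (`AlongHom L σ`), definitionally. [cite: GortzWedhorn2020, §(14.20)] -/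
theorem twist_eq_bcFunctor_alongHom :
    twist L σ = bcFunctor L (AlongHom L σ.toRingEquiv.toRingHom) := rfl

/-- The group `L`-scheme underlying `(P_L)^σ` is the twist of that of `P_L` (by `rfl`).
[cite: Milne2005ShimuraVarieties, §11 p. 108 («σV»)] -/
theorem conjugate_baseChange_toGrp :
    ((P.baseChange L).conjugate σ.toRingEquiv).toGrp = (twist L σ).mapGrp.obj (P.baseChange L).toGrp :=
  rfl

/-- **`(P ⊗_K L)^σ ≅ P ⊗_K L` for `σ ∈ Aut(L/K)`** (the conjugate of a base change by an
automorphism fixing `K` is the base change: `P` is «rational over `K`»; Shimura §21.1, Milne §11):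
the tree's `twistGrpIso` read as an isomorphism of abelian varieties over `L`.
[cite: Shimura1998, §21.1, proof of Prop. 21.1 (pp. 145–146)] [cite: Milne2005ShimuraVarieties, §11 p. 108] -/
def conjugateBaseChangeIso : (P.baseChange L).conjugate σ.toRingEquiv ≅ P.baseChange L :=
  InducedCategory.isoMk (twistGrpIso L σ P)

/-- On schemes the isomorphism is `twistIsoLeft`: `((x, t′), t) ↦ (x, t)`. [cite: GortzWedhorn2020, §(14.20)] -/
theorem toSchemeHom_conjugateBaseChangeIso_hom :
    Hom.toSchemeHom (conjugateBaseChangeIso L σ P).hom = (twistIsoLeft L σ P.X).hom :=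
  twistGrpIso_hom_hom_hom_left L σ P

/-- On schemes the inverse is `twistIsoLeft⁻¹`: `(x, t) ↦ ((x, σ t), t)`. [cite: GortzWedhorn2020, §(14.20)] -/
theorem toSchemeHom_conjugateBaseChangeIso_inv :
    Hom.toSchemeHom (conjugateBaseChangeIso L σ P).inv = (twistIsoLeft L σ P.X).inv :=
  twistGrpIso_inv_hom_hom_left L σ P

/-- The projection `(P_L)^σ → P_L` of the conjugate (`baseChangeHomFst`) is the first projection of
the twist (by `rfl`). [cite: GortzWedhorn2020, §(14.20)] -/
theorem baseChangeHomFst_conjugate_baseChange :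
    baseChangeHomFst σ.toRingEquiv.toRingHom (P.baseChange L).X =
      pullback.fst (pullback.snd P.X.hom (bcSpec K L)) (specAut L σ) := rfl

/-- **`e ≫ pr_P = (A^σ → A) ≫ pr_P`**: the isomorphism commutes with the projections to `P`.
[cite: GortzWedhorn2020, §(14.20)] -/
@[reassoc]
theorem toSchemeHom_conjugateBaseChangeIso_hom_comp_fst :
    Hom.toSchemeHom (conjugateBaseChangeIso L σ P).hom ≫ pullback.fst P.X.hom (bcSpec K L) =
      baseChangeHomFst σ.toRingEquiv.toRingHom (P.baseChange L).X ≫ pullback.fst P.X.hom (bcSpec K L) := by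
  rw [toSchemeHom_conjugateBaseChangeIso_hom, twistIsoLeft_hom_fst]
  rfl

/-- **`e⁻¹ ≫ (A^σ → A) = gal σ⁻¹ = 1 × Spec σ`**: read through the identification, the canonical
projection of the conjugate onto `P_L` is the Galois automorphism `1 × Spec σ` of `P ×_K Spec L`
(`AbelianVariety.gal`, convention `gal τ = 1 × Spec τ⁻¹`). [cite: GortzWedhorn2020, §(14.20) (14.20.1)] -/
@[reassoc]
theorem toSchemeHom_conjugateBaseChangeIso_inv_comp_baseChangeHomFst :
    Hom.toSchemeHom (conjugateBaseChangeIso L σ P).inv ≫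
        baseChangeHomFst σ.toRingEquiv.toRingHom (P.baseChange L).X = P.gal L σ⁻¹ := by
  rw [toSchemeHom_conjugateBaseChangeIso_inv, baseChangeHomFst_conjugate_baseChange, twistIsoLeft_inv_fst]

/-! ### The Galois action on `End(P_L)` is conjugation by `σ` -/

/-- **`σ • r = e⁻¹ ≫ r^σ ≫ e`**: the Galois conjugate `galConj σ r` of an endomorphism `r` of `P_L`
(`Motives/AbelianVarietyEndGaloisDescent`) is Shimura's `r^σ` (`Hom.conjugate`) read through
`(P_L)^σ ≅ P_L` (by `rfl`). [cite: Shimura1998, §21.4, proof of Thm. 21.4, pp. 147–148 («λ_{στ} = λ_σ^τ λ_τ»)]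
[cite: Milne2005ShimuraVarieties, §11 p. 108 («σα»)] -/
theorem galConj_eq_conj (r : P.baseChange L ⟶ P.baseChange L) :
    P.galConj L σ r =
      (conjugateBaseChangeIso L σ P).inv ≫ Hom.conjugate σ.toRingEquiv r ≫
        (conjugateBaseChangeIso L σ P).hom :=
  rfl

/-- The same for the `MulSemiringAction` on `End (P_L)`: `σ • r = e⁻¹ ≫ r^σ ≫ e`.
[cite: Milne2005ShimuraVarieties, §11 p. 108 («σα»)] -/
theorem smul_end_eq_conj (r : End (P.baseChange L)) :
    σ • r =
      (conjugateBaseChangeIso L σ P).inv ≫ Hom.conjugate σ.toRingEquiv r ≫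
        (conjugateBaseChangeIso L σ P).hom :=
  rfl

/-! ### Naturality: `K`-rational homomorphisms commute with the identification -/

variable {P} in
/-- **`(f_L)^σ ≫ e_Q = e_P ≫ f_L`** for a homomorphism `f : P → Q` over `K` («`f^σ = f` for `f`
rational over `K`»): naturality of `twistIso` lifted to abelian varieties.
[cite: Shimura1998, §21.1, proof of Prop. 21.1 (pp. 145–146: «ι′(a) … rational over k₀»)] [cite: Milne2005ShimuraVarieties, §11 p. 108] -/
@[reassoc]
theorem conjugate_baseChange_comp_conjugateBaseChangeIso_hom {Q : AbelianVariety K} (f : P ⟶ Q) :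
    Hom.conjugate σ.toRingEquiv (Hom.baseChange L f) ≫ (conjugateBaseChangeIso L σ Q).hom =
      (conjugateBaseChangeIso L σ P).hom ≫ Hom.baseChange L f := by
  apply hom_ext_toSchemeHom
  have hcomp : ∀ {A B C : AbelianVariety L} (a : A ⟶ B) (b : B ⟶ C),
      Hom.toSchemeHom (a ≫ b) = Hom.toSchemeHom a ≫ Hom.toSchemeHom b := fun _ _ ↦ rfl
  rw [hcomp, hcomp, toSchemeHom_conjugateBaseChangeIso_hom, toSchemeHom_conjugateBaseChangeIso_hom]
  have h := congrArg CommaMorphism.left ((twistIso L σ).hom.naturality f.hom.hom.hom)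
  simp only [Functor.comp_map, Over.comp_left, twistIso_hom_app_left] at h
  exact h

variable {P} in
/-- … and for the inverses: `e_P⁻¹ ≫ (f_L)^σ = f_L ≫ e_Q⁻¹`. [cite: Milne2005ShimuraVarieties, §11 p. 108] -/
@[reassoc]
theorem conjugateBaseChangeIso_inv_comp_conjugate_baseChange {Q : AbelianVariety K} (f : P ⟶ Q) :
    (conjugateBaseChangeIso L σ P).inv ≫ Hom.conjugate σ.toRingEquiv (Hom.baseChange L f) =
      Hom.baseChange L f ≫ (conjugateBaseChangeIso L σ Q).inv := by
  rw [Iso.inv_comp_eq, ← Category.assoc, Iso.eq_comp_inv,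
    conjugate_baseChange_comp_conjugateBaseChangeIso_hom]

/-- **Endomorphism form**: `e⁻¹ ≫ (f_L)^σ ≫ e = f_L` for `f ∈ End_K(P)`, i.e. `σ • f_L = f_L`
(`galConj_baseChange` of the cited file, now literally a statement about `Hom.conjugate`).
[cite: Shimura1998, §21.1, proof of Prop. 21.1 (pp. 145–146: «ι(a)^σ = ι(a)»)] -/
theorem conjugateBaseChangeIso_conj_baseChange (f : P ⟶ P) :
    (conjugateBaseChangeIso L σ P).inv ≫ Hom.conjugate σ.toRingEquiv (Hom.baseChange L f) ≫
        (conjugateBaseChangeIso L σ P).hom = Hom.baseChange L f := by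
  rw [conjugate_baseChange_comp_conjugateBaseChangeIso_hom, Iso.inv_hom_id_assoc]

/-! ### On points: `x ↦ x^σ` followed by the identification is the Galois action `σ • x` -/

/-- Two `L`-points of `P_L = P ×_K Spec L` over `L` with the same projection to `P` are equal.
[cite: GortzWedhorn2020, Section (4.7) (points of a base change)] -/
theorem Points.baseChange_ext {Q₁ Q₂ : (P.baseChange L).Points L}
    (h : Q₁.left ≫ pullback.fst P.X.hom (bcSpec K L) = Q₂.left ≫ pullback.fst P.X.hom (bcSpec K L)) :
    Q₁ = Q₂ := by
  apply (P.pointsEquiv L).symm.injective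
  ext : 1
  rw [pointsEquiv_symm_apply_left, pointsEquiv_symm_apply_left, h]

/-- **`e(x^σ) = σ • x`**: for `x ∈ P(L)`, read in `P_L(L)` via `pointsMulEquiv : P(L) ≃* P_L(L)`, the
conjugate point `x^σ ∈ (P_L)^σ(L)` (`conjPoints`, Shimura's `x ↦ x^σ`, coordinates transformed by `σ`)
is carried by `(P_L)^σ ≅ P_L` to the Galois translate `σ • x` (`AbelianVariety.Points.instMulDistribMulAction`,
`σ • x = Spec σ ≫ x`).  This is the identity `r(w)^σ = σ • r(w)` used to pass from Shimura's (19.10g)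
«`r(w)^{[x,k]}`» for a `k`-rational structure to the Galois action on its complex points.
[cite: Shimura1998, §21.4, proof of Thm. 21.4, pp. 147–148 («r₁(w)^σ = μ^σ(λ_σ(r(c_σ w)))»)] [cite: Milne2005ShimuraVarieties, §13 Prop. 13.1 («the actions of Aut(Ω/k) on V(Ω)»)] -/
theorem map_conjugateBaseChangeIso_hom_conjPoints (x : P.Points L) :
    AlgPoints.map (conjugateBaseChangeIso L σ P).hom.hom.hom.hom
        ((P.baseChange L).conjPoints σ.toRingEquiv (P.pointsMulEquiv L x)) =
      P.pointsMulEquiv L (σ • x) := by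
  apply Points.baseChange_ext
  rw [pointsMulEquiv_apply, pointsMulEquiv_apply, pointsEquiv_apply_left_comp_fst, AlgPoints.smul_def,
    Over.comp_left, AlgPoints.specMap_left, AlgPoints.map_apply, Over.comp_left, Category.assoc]
  change ((P.baseChange L).conjPoints σ.toRingEquiv (P.pointsEquiv L x)).left ≫
      Hom.toSchemeHom (conjugateBaseChangeIso L σ P).hom ≫ pullback.fst P.X.hom (bcSpec K L) = _
  rw [toSchemeHom_conjugateBaseChangeIso_hom_comp_fst, conjPoints_left_comp_fst_assoc]
  have hx : ((P.pointsEquiv L) x).left ≫ pullback.fst P.X.hom (bcSpec K L) = x.left :=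
    pointsEquiv_apply_left_comp_fst L P x
  simp only [Category.assoc, hx]
  rfl

/-- The same with the identification `P(L) ≃* P_L(L)` inverted: `σ • x = e(x^σ)` read in `P(L)`.
[cite: Shimura1998, §21.4, proof of Thm. 21.4, pp. 147–148] -/
theorem pointsMulEquiv_symm_map_conjugateBaseChangeIso_hom_conjPoints (Q : (P.baseChange L).Points L) :
    (P.pointsMulEquiv L).symm (AlgPoints.map (conjugateBaseChangeIso L σ P).hom.hom.hom.hom
        ((P.baseChange L).conjPoints σ.toRingEquiv Q)) =
      σ • (P.pointsMulEquiv L).symm Q := by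
  obtain ⟨x, rfl⟩ := (P.pointsMulEquiv L).surjective Q
  rw [map_conjugateBaseChangeIso_hom_conjPoints, MulEquiv.symm_apply_apply, MulEquiv.symm_apply_apply]

end AbelianVariety

end Literature.AlgebraicGeometry.Motives

end
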